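import Mathlib.Analysis.InnerProductSpace.PiL2

/-!
# Connelly's stress–energy identity (engine tool of crux `ReggeStarCoercivity.DefectFreeCrystallizes`, stmt-AtomisticToContinuum-13603)

Registered tool stub `stub_stressEnergy` of the line `palm-good-law` (skeleton v38, lead c11).  For a symmetric weight `β` on the
pairs of a finite point configuration `p` of `ℝ³` that is an EQUILIBRIUM STRESS (`Σ_j β i j • (p i − p j) = 0` at every point),
the `β`-weighted sum of the exact squared-distance deviations under an arbitrary finite displacement `u` equals the `β`-weighted
sum of the squared relative displacements.  This is the algebraic reason why a cluster certificate written in squared-distance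
deviations with self-stress first order has no linear part (lead c11, crux NOTES.md "Engine analysis").
(R. Connelly, "Rigidity and energy", Invent. Math. 66 (1982), §2). [folklore]
-/

noncomputable section

open scoped BigOperators

namespace Summit.AtomisticToContinuum.Crystallization.Theorems.PalmGoodLaw.StressEnergy

/-- The linear term of the squared-distance deviation: `‖(a + c) - (b + d)‖² − ‖a − b‖² = 2⟨a − b, c − d⟩ + ‖c − d‖²`. [folklore] -/
theorem normSq_sub_add_sub (a b c d : EuclideanSpace ℝ (Fin 3)) :
    ‖(a + c) - (b + d)‖ ^ 2 - ‖a - b‖ ^ 2 = 2 * inner ℝ (a - b) (c - d) + ‖c - d‖ ^ 2 := by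
  have h : (a + c) - (b + d) = (a - b) + (c - d) := by abel
  rw [h, norm_add_sq_real]
  ring

/-- **The cross term vanishes against an equilibrium stress**: `Σ_{i,j} β i j ⟨p i − p j, u i − u j⟩ = 0` when `β` is symmetric and
`Σ_j β i j • (p i − p j) = 0` for every `i`. (R. Connelly, "Rigidity and energy", Invent. Math. 66 (1982), §2). [folklore] -/
theorem sum_sum_inner_eq_zero {n : ℕ} (β : Fin n → Fin n → ℝ) (p u : Fin n → EuclideanSpace ℝ (Fin 3))
    (hsymm : ∀ i j, β i j = β j i) (heq : ∀ i, ∑ j, β i j • (p i - p j) = 0) :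
    ∑ i, ∑ j, β i j * inner ℝ (p i - p j) (u i - u j) = 0 := by
  -- split `⟨p i − p j, u i − u j⟩ = ⟨p i − p j, u i⟩ − ⟨p i − p j, u j⟩`
  have hsplit : ∀ i j, β i j * inner ℝ (p i - p j) (u i - u j) =
      β i j * inner ℝ (p i - p j) (u i) - β i j * inner ℝ (p i - p j) (u j) := by
    intro i j; rw [inner_sub_right]; ring
  simp_rw [hsplit, Finset.sum_sub_distrib]
  -- first double sum: `Σ_i ⟨Σ_j β i j • (p i − p j), u i⟩ = 0`
  have h1 : ∑ i, ∑ j, β i j * inner ℝ (p i - p j) (u i) = 0 := by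
    refine Finset.sum_eq_zero fun i _ => ?_
    have : ∑ j, β i j * inner ℝ (p i - p j) (u i) = inner ℝ (∑ j, β i j • (p i - p j)) (u i) := by
      rw [sum_inner]
      refine Finset.sum_congr rfl fun j _ => ?_
      rw [real_inner_smul_left]
    rw [this, heq i, inner_zero_left]
  -- second double sum: swap the order, use symmetry of `β` and antisymmetry of `p i − p j`
  have h2 : ∑ i, ∑ j, β i j * inner ℝ (p i - p j) (u j) = 0 := by
    rw [Finset.sum_comm]
    refine Finset.sum_eq_zero fun j _ => ?_
    have : ∑ i, β i j * inner ℝ (p i - p j) (u j) = inner ℝ (∑ i, β i j • (p i - p j)) (u j) := by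
      rw [sum_inner]
      refine Finset.sum_congr rfl fun i _ => ?_
      rw [real_inner_smul_left]
    rw [this]
    have hflip : ∑ i, β i j • (p i - p j) = -∑ i, β j i • (p j - p i) := by
      rw [← Finset.sum_neg_distrib]
      refine Finset.sum_congr rfl fun i _ => ?_
      rw [hsymm i j, ← smul_neg, neg_sub]
    rw [hflip, heq j, neg_zero, inner_zero_left]
  rw [h1, h2, sub_zero]

/-- **`stub_stressEnergy` — CONNELLY'S STRESS–ENERGY IDENTITY** (registered tool stub of crux stmt-AtomisticToContinuum-13603, line
`palm-good-law` v38): for a symmetric equilibrium stress `β` of the configuration `p`, and every displacement `u`,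
`Σ_{i,j} β i j (‖(p i + u i) − (p j + u j)‖² − ‖p i − p j‖²) = Σ_{i,j} β i j ‖u i − u j‖²`.
(R. Connelly, "Rigidity and energy", Invent. Math. 66 (1982), §2). [folklore] -/
theorem stub_stressEnergy :
    ∀ (n : ℕ) (β : Fin n → Fin n → ℝ) (p u : Fin n → EuclideanSpace ℝ (Fin 3)),
      (∀ i j, β i j = β j i) → (∀ i, ∑ j, β i j • (p i - p j) = 0) →
      ∑ i, ∑ j, β i j * (‖(p i + u i) - (p j + u j)‖ ^ 2 - ‖p i - p j‖ ^ 2) = ∑ i, ∑ j, β i j * ‖u i - u j‖ ^ 2 := by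
  intro n β p u hsymm heq
  have hterm : ∀ i j, β i j * (‖(p i + u i) - (p j + u j)‖ ^ 2 - ‖p i - p j‖ ^ 2) =
      2 * (β i j * inner ℝ (p i - p j) (u i - u j)) + β i j * ‖u i - u j‖ ^ 2 := by
    intro i j; rw [normSq_sub_add_sub]; ring
  simp_rw [hterm, Finset.sum_add_distrib, ← Finset.mul_sum]
  rw [sum_sum_inner_eq_zero β p u hsymm heq, mul_zero, zero_add]

end Summit.AtomisticToContinuum.Crystallization.Theorems.PalmGoodLaw.StressEnergy

end
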